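import Literature.AnabelianGeometry.SemiGraphs.TemperedDecompositionSubgroups
import Literature.AnabelianGeometry.SemiGraphs.TemperedCoveringsTemperedLimitsProofs
import HarnessLib

/-!
# Existence of the decomposition homomorphisms `π₁^temp(𝒢_ℍ) → π₁^temp(𝒢)`: the restriction `B^temp(𝒢) → B^temp(𝒢_ℍ)` is a morphism of temperoids

Mochizuki, *Semi-graphs of anabelioids*, Publ. RIMS **42** (2006), §3: Def. 3.1 (iii) p. 33 (a morphism
of temperoids is a functor preserving finite limits and countable colimits), Prop. 3.2 p. 35 (such a
functor between `B^temp(Π')`, `B^temp(Π)` is `B^temp(φ)` for a continuous `φ : Π → Π'`), §3 p. 36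
(`B^cov(𝒢)`: "objects given by data `{S_v, φ_e}` … morphisms … between such data" — limits and colimits
are computed COMPONENTWISE), Def. 3.5 (ii) p. 37 (restriction of coverings)
[cite: MochizukiSemiAnbd2006, Prop 3.2 p.35]; Mochizuki, *Inter-universal Teichmüller theory I*, §2
p. 44 ("natural … decomposition groups `Π^tp_ℍ ⊆ Π^tp_𝔾`") [cite: Mochizuki2012, IUTchI §2 p.44].

PROOF-ONLY sequel of `TemperedDecompositionSubgroups.lean` (abc-iut-w4-d052, rows «DECOMP-SUBGRAPH» /
«DECOMP-EXISTS», GAP row G-w5d028-2 target No. 2).  There the existence of a decomposition homomorphism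
for given charts `c` of `𝒢`, `c'` of `𝒢_ℍ` was reduced (`exists_isDecompHom_of_preserves`) to: the
restriction functor `c.equiv⁻¹ ⋙ (B^temp(𝒢) → B^temp(𝒢_ℍ)) ⋙ c'.equiv` preserves finite limits and
countable colimits.  This file proves that and hence DISCHARGES the target:

* `CovObj.isLimit_of_components` / `CovObj.isColimit_of_components` — a cone (cocone) in `B^cov(𝒢)` all
  of whose images under the restrictions `S ↦ S_v`, `S ↦ S_e` are limit cones (colimit cocones) is a
  limit (colimit): the universal property componentwise, the compatibility of the lift with the gluings
  from the uniqueness part at `B^temp(b_*)(S_v)` (abc-iut-L3-t2's inline argument of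
  `CovObj.exists_limitCone` made reusable);
* `covRestrict_preservesLimitsOfShape` / `covRestrict_preservesColimitsOfShape` — restriction to a
  sub-semi-graph preserves finite limits and countable colimits (componentwise it is the identity);
* `btempRestrict_preservesLimitsOfShape` / `btempRestrict_preservesColimitsOfShape` — the same for
  `B^temp(𝒢) → B^temp(𝒢_ℍ)` (full subcategories closed under these (co)limits);
* **`TemperedPiChart.decompHomExists`** — for every chart `c` of `𝒢` and `c'` of `𝒢_ℍ` there IS a
  decomposition homomorphism `c'.G → c.G` ([SemiAnbd] Prop. 3.2 via `TemperoidHomEqRes_holds`), hence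
  `TemperedPiChart.decompSubgroups_nonempty` — the consumer's non-emptiness of `decompSubgroups c ℍ`
  given ANY chart of `𝒢_ℍ`.

Category-theoretic plumbing over the L3 interface; nothing here takes a side on [IUTchIII] Cor. 3.12.
-/

noncomputable section

open CategoryTheory CategoryTheory.Limits

namespace Literature.AnabelianGeometry.SemiGraphs

namespace ProfiniteSemiGraph

universe u

variable {𝒢 : ProfiniteSemiGraph.{u}}

namespace CovObj

/-! ### Componentwise (co)limit criterion in `B^cov(𝒢)` -/

/-- **A cone of `B^cov(𝒢)` is a limit as soon as all its vertex and edge components are limits**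
(finite shape): lift componentwise; the lift is compatible with the gluings by the uniqueness part of
the universal property at `B^temp(b_*)(L_v)` (`B^temp(b_*)` preserves finite limits).
[cite: MochizukiSemiAnbd2006, §3 p.36] -/
theorem isLimit_of_components {J : Type} [SmallCategory J] [FinCategory J] {K : J ⥤ CovObj 𝒢}
    (d : Cone K) (hV : ∀ v, IsLimit ((restrictV 𝒢 v).mapCone d))
    (hE : ∀ e, IsLimit ((restrictE 𝒢 e).mapCone d)) : Nonempty (IsLimit d) := by
  haveI : ∀ (b : 𝒢.graph.Branch) (v : 𝒢.graph.Vertex) (h : 𝒢.graph.abuts b = some v),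
      PreservesLimitsOfShape J (BTemp.res (𝒢.brHom b v h)) :=
    fun b v h => btempRes_preservesLimitsOfShape _ J
  refine ⟨{ lift := fun s => ?_, fac := ?_, uniq := ?_ }⟩
  · refine
      { fV := fun v => (hV v).lift ((restrictV 𝒢 v).mapCone s)
        fE := fun e => (hE e).lift ((restrictE 𝒢 e).mapCone s)
        comm := fun b v h => ?_ }
    -- test the two morphisms into `B^temp(b_*)(L_v)` against the limit cone `B^temp(b_*)(L_v → (K j)_v)`
    apply (isLimitOfPreserves (BTemp.res (𝒢.brHom b v h)) (hV v)).hom_ext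
    intro j
    change ((hE _).lift ((restrictE 𝒢 _).mapCone s) ≫ (d.pt.glue b v h).hom) ≫
        (BTemp.res (𝒢.brHom b v h)).map ((d.π.app j).fV v) =
      ((s.pt.glue b v h).hom ≫ (BTemp.res (𝒢.brHom b v h)).map ((hV v).lift ((restrictV 𝒢 v).mapCone s))) ≫
        (BTemp.res (𝒢.brHom b v h)).map ((d.π.app j).fV v)
    have h1 : (hE (𝒢.graph.edgeOf b)).lift ((restrictE 𝒢 _).mapCone s) ≫ (d.π.app j).fE (𝒢.graph.edgeOf b) =
        (s.π.app j).fE (𝒢.graph.edgeOf b) := (hE _).fac ((restrictE 𝒢 _).mapCone s) j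
    have h2 : (hV v).lift ((restrictV 𝒢 v).mapCone s) ≫ (d.π.app j).fV v = (s.π.app j).fV v :=
      (hV v).fac ((restrictV 𝒢 v).mapCone s) j
    have hdcomm : (d.π.app j).fE (𝒢.graph.edgeOf b) ≫ ((K.obj j).glue b v h).hom =
        (d.pt.glue b v h).hom ≫ (BTemp.res (𝒢.brHom b v h)).map ((d.π.app j).fV v) :=
      (d.π.app j).comm b v h
    have hscomm : (s.π.app j).fE (𝒢.graph.edgeOf b) ≫ ((K.obj j).glue b v h).hom =
        (s.pt.glue b v h).hom ≫ (BTemp.res (𝒢.brHom b v h)).map ((s.π.app j).fV v) :=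
      (s.π.app j).comm b v h
    have eL : (hE (𝒢.graph.edgeOf b)).lift ((restrictE 𝒢 _).mapCone s) ≫ (d.pt.glue b v h).hom ≫
        (BTemp.res (𝒢.brHom b v h)).map ((d.π.app j).fV v) =
          (s.π.app j).fE (𝒢.graph.edgeOf b) ≫ ((K.obj j).glue b v h).hom := by
      erw [← hdcomm]
      exact (reassoc_of% h1) ((K.obj j).glue b v h).hom
    have eR : (s.pt.glue b v h).hom ≫ (BTemp.res (𝒢.brHom b v h)).map ((hV v).lift ((restrictV 𝒢 v).mapCone s)) ≫
        (BTemp.res (𝒢.brHom b v h)).map ((d.π.app j).fV v) =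
          (s.π.app j).fE (𝒢.graph.edgeOf b) ≫ ((K.obj j).glue b v h).hom := by
      rw [← Functor.map_comp]; erw [h2]; exact hscomm.symm
    rw [Category.assoc, Category.assoc]
    exact eL.trans eR.symm
  · intro s j
    apply hom_ext'
    · intro v
      exact (hV v).fac ((restrictV 𝒢 v).mapCone s) j
    · intro e
      exact (hE e).fac ((restrictE 𝒢 e).mapCone s) j
  · intro s m hm
    apply hom_ext'
    · intro v
      exact (hV v).uniq ((restrictV 𝒢 v).mapCone s) (m.fV v)
        fun j => congrArg (fun k : s.pt ⟶ K.obj j => k.fV v) (hm j)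
    · intro e
      exact (hE e).uniq ((restrictE 𝒢 e).mapCone s) (m.fE e)
        fun j => congrArg (fun k : s.pt ⟶ K.obj j => k.fE e) (hm j)

/-- **A cocone of `B^cov(𝒢)` is a colimit as soon as all its vertex and edge components are colimits**
(countable shape): descend componentwise; compatibility with the gluings by the uniqueness part at the
colimit `L_e`. [cite: MochizukiSemiAnbd2006, §3 p.36] -/
theorem isColimit_of_components {J : Type} [SmallCategory J] [CountableCategory J] {K : J ⥤ CovObj 𝒢}
    (d : Cocone K) (hV : ∀ v, IsColimit ((restrictV 𝒢 v).mapCocone d))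
    (hE : ∀ e, IsColimit ((restrictE 𝒢 e).mapCocone d)) : Nonempty (IsColimit d) := by
  refine ⟨{ desc := fun s => ?_, fac := ?_, uniq := ?_ }⟩
  · refine
      { fV := fun v => (hV v).desc ((restrictV 𝒢 v).mapCocone s)
        fE := fun e => (hE e).desc ((restrictE 𝒢 e).mapCocone s)
        comm := fun b v h => ?_ }
    -- test the two morphisms out of the colimit `L_e` against its cocone
    apply (hE (𝒢.graph.edgeOf b)).hom_ext
    intro j
    change (d.ι.app j).fE (𝒢.graph.edgeOf b) ≫ (hE _).desc ((restrictE 𝒢 _).mapCocone s) ≫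
        (s.pt.glue b v h).hom =
      (d.ι.app j).fE (𝒢.graph.edgeOf b) ≫ (d.pt.glue b v h).hom ≫
        (BTemp.res (𝒢.brHom b v h)).map ((hV v).desc ((restrictV 𝒢 v).mapCocone s))
    have h1 : (d.ι.app j).fE (𝒢.graph.edgeOf b) ≫ (hE _).desc ((restrictE 𝒢 _).mapCocone s) =
        (s.ι.app j).fE (𝒢.graph.edgeOf b) := (hE _).fac ((restrictE 𝒢 _).mapCocone s) j
    have h2 : (d.ι.app j).fV v ≫ (hV v).desc ((restrictV 𝒢 v).mapCocone s) = (s.ι.app j).fV v :=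
      (hV v).fac ((restrictV 𝒢 v).mapCocone s) j
    have hdcomm : (d.ι.app j).fE (𝒢.graph.edgeOf b) ≫ (d.pt.glue b v h).hom =
        ((K.obj j).glue b v h).hom ≫ (BTemp.res (𝒢.brHom b v h)).map ((d.ι.app j).fV v) :=
      (d.ι.app j).comm b v h
    have hscomm : (s.ι.app j).fE (𝒢.graph.edgeOf b) ≫ (s.pt.glue b v h).hom =
        ((K.obj j).glue b v h).hom ≫ (BTemp.res (𝒢.brHom b v h)).map ((s.ι.app j).fV v) :=
      (s.ι.app j).comm b v h
    have eL : (d.ι.app j).fE (𝒢.graph.edgeOf b) ≫ (hE _).desc ((restrictE 𝒢 _).mapCocone s) ≫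
        (s.pt.glue b v h).hom =
          ((K.obj j).glue b v h).hom ≫ (BTemp.res (𝒢.brHom b v h)).map ((s.ι.app j).fV v) := by
      exact ((reassoc_of% h1) (s.pt.glue b v h).hom).trans hscomm
    have eR : (d.ι.app j).fE (𝒢.graph.edgeOf b) ≫ (d.pt.glue b v h).hom ≫
        (BTemp.res (𝒢.brHom b v h)).map ((hV v).desc ((restrictV 𝒢 v).mapCocone s)) =
          ((K.obj j).glue b v h).hom ≫ (BTemp.res (𝒢.brHom b v h)).map ((s.ι.app j).fV v) := by
      refine ((reassoc_of% hdcomm)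
        ((BTemp.res (𝒢.brHom b v h)).map ((hV v).desc ((restrictV 𝒢 v).mapCocone s)))).trans ?_
      refine (Category.assoc _ _ _).trans ?_
      have h2' := congrArg (fun t => ((K.obj j).glue b v h).hom ≫ (BTemp.res (𝒢.brHom b v h)).map t) h2
      erw [Functor.map_comp] at h2'
      exact h2'
    exact eL.trans eR.symm
  · intro s j
    apply hom_ext'
    · intro v
      exact (hV v).fac ((restrictV 𝒢 v).mapCocone s) j
    · intro e
      exact (hE e).fac ((restrictE 𝒢 e).mapCocone s) j
  · intro s m hm
    apply hom_ext'
    · intro v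
      exact (hV v).uniq ((restrictV 𝒢 v).mapCocone s) (m.fV v)
        fun j => congrArg (fun k : K.obj j ⟶ s.pt => k.fV v) (hm j)
    · intro e
      exact (hE e).uniq ((restrictE 𝒢 e).mapCocone s) (m.fE e)
        fun j => congrArg (fun k : K.obj j ⟶ s.pt => k.fE e) (hm j)

end CovObj

/-! ### Restriction to a sub-semi-graph preserves finite limits and countable colimits -/

section Restrict

variable (H : 𝒢.graph.Subgraph)

/-- `B^cov(𝒢) → B^cov(𝒢_ℍ)` preserves finite limits (componentwise it is the identity).
[cite: MochizukiSemiAnbd2006, Def 3.5(ii) p.37] -/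
theorem covRestrict_preservesLimitsOfShape (J : Type) [SmallCategory J] [FinCategory J] :
    PreservesLimitsOfShape J (𝒢.covRestrict H) :=
  ⟨fun {K} => by
    obtain ⟨c, hc, hV, hE⟩ := CovObj.exists_limitCone K
    exact preservesLimit_of_preserves_limit_cone hc
      (CovObj.isLimit_of_components ((𝒢.covRestrict H).mapCone c)
        (fun w => (hV w.1).some) (fun e => (hE e.1).some)).some⟩

/-- `B^cov(𝒢) → B^cov(𝒢_ℍ)` preserves countable colimits. [cite: MochizukiSemiAnbd2006, Def 3.5(ii) p.37] -/
theorem covRestrict_preservesColimitsOfShape (J : Type) [SmallCategory J] [CountableCategory J] :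
    PreservesColimitsOfShape J (𝒢.covRestrict H) :=
  ⟨fun {K} => by
    obtain ⟨c, hc, hV, hE⟩ := CovObj.exists_colimitCocone K
    exact preservesColimit_of_preserves_colimit_cocone hc
      (CovObj.isColimit_of_components ((𝒢.covRestrict H).mapCocone c)
        (fun w => (hV w.1).some) (fun e => (hE e.1).some)).some⟩

/-- `B^temp(𝒢) → B^temp(𝒢_ℍ)` preserves finite limits (the tempered objects are closed under them
on both sides, `isTempered_isClosedUnderLimitsOfShape`). [cite: MochizukiSemiAnbd2006, Prop 3.6(ii) p.38] -/
theorem btempRestrict_preservesLimitsOfShape (J : Type) [SmallCategory J] [FinCategory J] :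
    PreservesLimitsOfShape J (𝒢.btempRestrict H) := by
  haveI := isTempered_isClosedUnderLimitsOfShape (𝒢 := 𝒢) J
  haveI := isTempered_isClosedUnderLimitsOfShape (𝒢 := 𝒢.restrict H) J
  haveI := CovObj.hasLimitsOfShape (𝒢 := 𝒢) (J := J)
  haveI := CovObj.hasLimitsOfShape (𝒢 := 𝒢.restrict H) (J := J)
  haveI := covRestrict_preservesLimitsOfShape H J
  have h : PreservesLimitsOfShape J (𝒢.btempRestrict H ⋙ ObjectProperty.ι _) := by
    rw [btempRestrict_comp_ι]; infer_instance
  exact preservesLimitsOfShape_of_reflects_of_preserves (𝒢.btempRestrict H) (ObjectProperty.ι _)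

/-- `B^temp(𝒢) → B^temp(𝒢_ℍ)` preserves countable colimits. [cite: MochizukiSemiAnbd2006, Prop 3.6(ii) p.38] -/
theorem btempRestrict_preservesColimitsOfShape (J : Type) [SmallCategory J] [CountableCategory J] :
    PreservesColimitsOfShape J (𝒢.btempRestrict H) := by
  haveI := isTempered_isClosedUnderColimitsOfShape (𝒢 := 𝒢) J
  haveI := isTempered_isClosedUnderColimitsOfShape (𝒢 := 𝒢.restrict H) J
  haveI := CovObj.hasColimitsOfShape (𝒢 := 𝒢) (J := J)
  haveI := CovObj.hasColimitsOfShape (𝒢 := 𝒢.restrict H) (J := J)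
  haveI := covRestrict_preservesColimitsOfShape H J
  have h : PreservesColimitsOfShape J (𝒢.btempRestrict H ⋙ ObjectProperty.ι _) := by
    rw [btempRestrict_comp_ι]; infer_instance
  exact preservesColimitsOfShape_of_reflects_of_preserves (𝒢.btempRestrict H) (ObjectProperty.ι _)

end Restrict

/-! ### Existence of decomposition homomorphisms; non-emptiness of `decompSubgroups` -/

namespace TemperedPiChart

/-- **The decomposition homomorphism `π₁^temp(𝒢_ℍ) → π₁^temp(𝒢)` EXISTS** for every chart `c` of `𝒢`
and every chart `c'` of `𝒢_ℍ` (target No. 2 of `TemperedDecompositionSubgroups.lean` DISCHARGED): the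
restriction functor read through the charts preserves finite limits and countable colimits, so
[SemiAnbd] Prop. 3.2 (`TemperoidHomEqRes_holds`, via `exists_isDecompHom_of_preserves`) produces a
continuous `φ : c'.G → c.G` with `B^temp(φ) ≅` the restriction. [cite: MochizukiSemiAnbd2006, Prop 3.2 p.35] -/
theorem decompHomExists (c : TemperedPiChart 𝒢) (H : 𝒢.graph.Subgraph) : c.DecompHomExists H := by
  intro c'
  refine c.exists_isDecompHom_of_preserves (H := H) c' ⟨fun J _ _ => ?_⟩ fun J _ _ => ?_
  · haveI := btempRestrict_preservesLimitsOfShape H J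
    infer_instance
  · haveI := btempRestrict_preservesColimitsOfShape H J
    infer_instance

/-- **`decompSubgroups c ℍ` is non-empty** as soon as `𝒢_ℍ` has a tempered fundamental group (any chart
`c'`). [cite: Mochizuki2012, IUTchI §2 p.44] -/
theorem decompSubgroups_nonempty (c : TemperedPiChart 𝒢) (H : 𝒢.graph.Subgraph)
    (c' : TemperedPiChart (𝒢.restrict H)) : (c.decompSubgroups H).Nonempty :=
  decompSubgroups_nonempty_of_exists (c.decompHomExists H) c'

end TemperedPiChart

end ProfiniteSemiGraph

end Literature.AnabelianGeometry.SemiGraphs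

end
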